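import Mathlib
import Literature.MathematicalPhysics.QuantumFieldTheory.Luscher2010.TrivializingMaps
import Literature.MathematicalPhysics.QuantumFieldTheory.Luscher2010.FlowActionSeries
import Summits.Ventures.LatticeQCDFlow.TrivializingMaps.Truncation
import Summits.Ventures.LatticeQCDFlow.TrivializingMaps.SeriesUniqueness
import Summits.Ventures.LatticeQCDFlow.TrivializingMaps.LuscherSeriesExistence
import HarnessLib

/-!
# The volume law `|𝓥_N| ≤ b·|E|` (`ExtensiveDefect`) reduced to two volume-uniform gradient bounds

HONEST FRAMING: exact (Metropolis-corrected) sampling algorithms for lattice gauge theory; figures of merit are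
autocorrelation/cost numbers at stated couplings and volumes; no continuum-physics claim.

Lüscher, CMP 293 (2010) 899, §4.3–4.5: the truncation defect `𝓥 = ∑_{x,μ,a} ∂^a_{x,μ} S · ∂^a_{x,μ} S̃^{(N)}` of
the order-`N` trivializing map is a sum over links of LOCAL terms, hence `O(|E|)` with a volume-independent
constant. This file proves the typed venture target `ExtensiveDefect d n N` of `Truncation.lean` §4 from two
inputs that carry exactly the volume-uniform analysis:

* (W) a bound `|∂_{e,Y} S_W(ιU)| ≤ c_W` for all lattices `L`, links `e`, unit directions `Y ∈ 𝔰𝔲(n)` and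
  `U ∈ SU(n)^E` (the Wilson action has bounded link gradients, uniformly in the volume);
* (A) a bound `|∂_{e,Y} G^{(N)}_{e₀}(ιU)| ≤ c_A` for the anchored terms of the constructed Lüscher series
  (`LuscherSeriesExistence.anchTerm`), uniformly in `L`, the basis `B`, the anchor `e₀`, the link `e`.

The reduction (`extensiveDefect_of`): by uniqueness of Lüscher series up to constants (`SeriesUniqueness`,
`IsLuscherSeries.luscherV_eq`) the defect of ANY smooth solution `Sk` equals that of the constructed one,
`S̃^{(N)} = ∑_{e₀} G^{(N)}_{e₀}`; the `e₀`-term only involves links `e ∈ linkBall (N+1) e₀`, at most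
`(1 + 16d²)^{N+1}` of them (`card_filter_linkBall_le`), and at most `dim_ℝ M_n(ℂ)` colour directions `a`
(`suBasis_card_le`: orthonormal generators are linearly independent), each of Frobenius norm `≤ 1`
(`suBasis_norm_le_one`: `‖T_a‖² = -Re tr T_a² = 1/2`). Inputs (W) and (A) are discharged in
`WilsonGradientBound` and `ExtensiveDefect`. Reference: M. Lüscher, CMP 293 (2010) 899 [Luscher2010Trivializing,
arXiv:0907.5491], §4.3 eqs. (4.14)–(4.15), §4.5.
-/

namespace Summit.Ventures.LatticeQCDFlow.TrivializingMaps

open MeasureTheory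
open Literature.MathematicalPhysics.QuantumFieldTheory
open Literature.MathematicalPhysics.QuantumFieldTheory.Luscher2010
open scoped Matrix Matrix.Norms.Frobenius ContDiff

noncomputable section

variable {d L n : ℕ} [NeZero L]

/-! ## §1. Basis-uniform bounds for orthonormal generators of `𝔰𝔲(n)` -/

omit [NeZero L] in
/-- The generators of an `SuBasis` are linearly independent over `ℝ` (pair `∑ c_a T_a = 0` with `T_b` under the
trace form `tr T_a T_b = -δ_{ab}/2`). [cite: Luscher2010Trivializing, App. A eq. (A.1)] -/
theorem suBasis_linearIndependent (B : SuBasis n) : LinearIndependent ℝ B.T := by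
  rw [Fintype.linearIndependent_iff]
  intro g hg b
  have h := congrArg (fun M : Matrix (Fin n) (Fin n) ℂ => (M * B.T b).trace) hg
  rw [Finset.sum_mul, Matrix.trace_sum] at h
  simp only [zero_mul, Matrix.trace_zero, smul_mul_assoc, Matrix.trace_smul, B.orth, smul_ite,
    smul_zero, Finset.sum_ite_eq', Finset.mem_univ, if_true] at h
  rw [Complex.real_smul] at h
  have h2 : (g b : ℂ) = 0 := by
    rcases mul_eq_zero.1 h with h | h
    · exact h
    · norm_num at h
  exact_mod_cast h2

omit [NeZero L] in
/-- Hence an `SuBasis` has at most `dim_ℝ M_n(ℂ)` (`= 2n²`) elements — a bound uniform in the basis.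
[cite: Luscher2010Trivializing, App. A] -/
theorem suBasis_card_le (B : SuBasis n) :
    Fintype.card B.ι ≤ Module.finrank ℝ (Matrix (Fin n) (Fin n) ℂ) := by
  haveI : Module.Finite ℝ (Matrix (Fin n) (Fin n) ℂ) := inferInstanceAs (Module.Finite ℝ (Fin n → Fin n → ℂ))
  exact (suBasis_linearIndependent B).fintype_card_le_finrank

omit [NeZero L] in
/-- `‖T_a‖_F² = 1/2` for every generator of an `SuBasis` (`‖T‖_F² = tr Tᴴ T = -tr T² = 1/2`).
[cite: Luscher2010Trivializing, App. A eq. (A.1)] -/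
theorem suBasis_norm_sq (B : SuBasis n) (a : B.ι) : ‖B.T a‖ ^ 2 = 1 / 2 := by
  have hmem := (mem_suAlgebra_iff (B.T a)).1 (B.mem a)
  have horth : (B.T a * B.T a).trace = -(1 / 2 : ℂ) := by rw [B.orth a a, if_pos rfl]
  have h1 : ((‖B.T a‖ ^ 2 : ℝ) : ℂ) = ((B.T a)ᴴ * B.T a).trace := by
    rw [WilsonFlow.frobenius_norm_sq]
    simp only [Matrix.trace, Matrix.diag_apply, Matrix.mul_apply, Matrix.conjTranspose_apply,
      Complex.star_def]
    push_cast
    rw [Finset.sum_comm]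
    refine Finset.sum_congr rfl fun i _ => Finset.sum_congr rfl fun j _ => ?_
    rw [Complex.conj_mul']
  rw [hmem.1, neg_mul, Matrix.trace_neg, horth, neg_neg] at h1
  have h2 : ((‖B.T a‖ ^ 2 : ℝ) : ℂ) = ((1 / 2 : ℝ) : ℂ) := by rw [h1]; push_cast; ring
  exact Complex.ofReal_injective h2

omit [NeZero L] in
/-- In particular `‖T_a‖_F ≤ 1`: the generators lie in the unit ball, uniformly in the basis. [folklore] -/
theorem suBasis_norm_le_one (B : SuBasis n) (a : B.ι) : ‖B.T a‖ ≤ 1 := by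
  have h := suBasis_norm_sq B a
  nlinarith [norm_nonneg (B.T a)]

/-! ## §2. Volume-independent counting: plaquettes through a link, plaquette balls -/

section Counting

attribute [local instance] Classical.propDecidable

omit [NeZero L] in
/-- A sum supported on `s` with terms bounded by `K` is at most `|s|·K` in absolute value. [folklore] -/
theorem abs_sum_le_card_mul {ι : Type*} [Fintype ι] (s : Finset ι) (g : ι → ℝ) {K : ℝ}
    (h0 : ∀ i ∉ s, g i = 0) (hK : ∀ i ∈ s, |g i| ≤ K) : |∑ i, g i| ≤ s.card * K := by
  rw [← Finset.sum_subset (Finset.subset_univ s) (fun i _ hi => h0 i hi)]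
  calc |∑ i ∈ s, g i| ≤ ∑ i ∈ s, |g i| := Finset.abs_sum_le_sum_abs _ _
    _ ≤ ∑ _i ∈ s, K := Finset.sum_le_sum hK
    _ = s.card * K := by rw [Finset.sum_const, nsmul_eq_mul]

/-- **At most `4d²` plaquettes pass through a given link**, on every periodic lattice (the base point of such a
plaquette `(x; μ, ν)` is `e.1`, `e.1 - μ̂` or `e.1 - ν̂`). [folklore] -/
theorem card_filter_plaqLinks_le (e : Edge d L) :
    (Finset.univ.filter (fun p : Site d L × Fin d × Fin d => e ∈ plaqLinks p.1 p.2.1 p.2.2)).card ≤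
      4 * (d * d) := by
  let g : Fin 4 × (Fin d × Fin d) → Site d L × Fin d × Fin d := fun q =>
    (if q.1 = 0 then e.1 else if q.1 = 1 then e.1 - Pi.single q.2.1 1
      else if q.1 = 2 then e.1 - Pi.single q.2.2 1 else e.1, q.2.1, q.2.2)
  have hsub : Finset.univ.filter (fun p : Site d L × Fin d × Fin d => e ∈ plaqLinks p.1 p.2.1 p.2.2) ⊆
      Finset.univ.image g := by
    intro p hp
    rw [Finset.mem_filter] at hp
    obtain ⟨x, μ, ν⟩ := p
    have h := hp.2
    simp only [plaqLinks, Set.mem_insert_iff, Set.mem_singleton_iff, Site.shift] at h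
    rw [Finset.mem_image]
    rcases h with h | h | h | h
    · exact ⟨(0, μ, ν), Finset.mem_univ _, by simp [g, h]⟩
    · exact ⟨(1, μ, ν), Finset.mem_univ _, by simp [g, h]⟩
    · exact ⟨(2, μ, ν), Finset.mem_univ _, by simp [g, h]⟩
    · exact ⟨(3, μ, ν), Finset.mem_univ _, by simp [g, h]⟩
  calc _ ≤ (Finset.univ.image g).card := Finset.card_le_card hsub
    _ ≤ (Finset.univ : Finset (Fin 4 × (Fin d × Fin d))).card := Finset.card_image_le
    _ = 4 * (d * d) := by simp

/-- A plaquette has at most four links. [folklore] -/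
theorem card_filter_mem_plaqLinks_le (x : Site d L) (μ ν : Fin d) :
    (Finset.univ.filter (fun e' : Edge d L => e' ∈ plaqLinks x μ ν)).card ≤ 4 := by
  have hsub : Finset.univ.filter (fun e' : Edge d L => e' ∈ plaqLinks x μ ν) ⊆
      insert (x, μ) (insert (x.shift μ, ν) (insert (x.shift ν, μ) {(x, ν)})) := by
    intro e' he'
    rw [Finset.mem_filter] at he'
    simpa [plaqLinks, Set.mem_insert_iff, Set.mem_singleton_iff] using he'.2
  refine (Finset.card_le_card hsub).trans ?_
  have h1 := Finset.card_insert_le (x, μ) (insert (x.shift μ, ν) (insert (x.shift ν, μ) ({(x, ν)} : Finset (Edge d L))))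
  have h2 := Finset.card_insert_le (x.shift μ, ν) (insert (x.shift ν, μ) ({(x, ν)} : Finset (Edge d L)))
  have h3 := Finset.card_insert_le (x.shift ν, μ) ({(x, ν)} : Finset (Edge d L))
  simp only [Finset.card_singleton] at h3
  omega

/-- **The plaquette neighbourhood of a link has at most `16d²` links.** [folklore] -/
theorem card_filter_plaqNbhd_le (e : Edge d L) :
    (Finset.univ.filter (fun e' : Edge d L => e' ∈ plaqNbhd e)).card ≤ 16 * (d * d) := by
  set S := Finset.univ.filter (fun p : Site d L × Fin d × Fin d => e ∈ plaqLinks p.1 p.2.1 p.2.2) with hS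
  have hsub : Finset.univ.filter (fun e' : Edge d L => e' ∈ plaqNbhd e) ⊆
      S.biUnion (fun p => Finset.univ.filter (fun e' : Edge d L => e' ∈ plaqLinks p.1 p.2.1 p.2.2)) := by
    intro e' he'
    rw [Finset.mem_filter] at he'
    obtain ⟨x, μ, ν, -, he, he''⟩ := he'.2
    rw [Finset.mem_biUnion]
    exact ⟨(x, μ, ν), Finset.mem_filter.2 ⟨Finset.mem_univ _, he⟩,
      Finset.mem_filter.2 ⟨Finset.mem_univ _, he''⟩⟩
  calc _ ≤ (S.biUnion fun p => Finset.univ.filter (fun e' : Edge d L => e' ∈ plaqLinks p.1 p.2.1 p.2.2)).card :=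
        Finset.card_le_card hsub
    _ ≤ ∑ p ∈ S, (Finset.univ.filter (fun e' : Edge d L => e' ∈ plaqLinks p.1 p.2.1 p.2.2)).card :=
        Finset.card_biUnion_le
    _ ≤ ∑ _p ∈ S, 4 := Finset.sum_le_sum fun p _ => card_filter_mem_plaqLinks_le p.1 p.2.1 p.2.2
    _ = S.card * 4 := by rw [Finset.sum_const, smul_eq_mul]
    _ ≤ 4 * (d * d) * 4 := by gcongr; exact card_filter_plaqLinks_le e
    _ = 16 * (d * d) := by ring

/-- **Plaquette balls have volume-independent size**: `|linkBall R e| ≤ (1 + 16d²)^R`.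
[cite: Luscher2010Trivializing, §4.3 ("the footprint grows linearly with the order")] -/
theorem card_filter_linkBall_le (e : Edge d L) :
    ∀ R : ℕ, (Finset.univ.filter (fun e' : Edge d L => e' ∈ linkBall R e)).card ≤ (1 + 16 * (d * d)) ^ R
  | 0 => by
    have hsub : Finset.univ.filter (fun e' : Edge d L => e' ∈ linkBall 0 e) ⊆ {e} := by
      intro e' he'
      rw [Finset.mem_filter] at he'
      have h := he'.2
      simp only [linkBall, Set.mem_singleton_iff] at h
      simp [h]
    calc _ ≤ ({e} : Finset (Edge d L)).card := Finset.card_le_card hsub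
      _ = (1 + 16 * (d * d)) ^ 0 := by simp
  | R + 1 => by
    set T := Finset.univ.filter (fun e' : Edge d L => e' ∈ linkBall R e) with hT
    have hsub : Finset.univ.filter (fun e' : Edge d L => e' ∈ linkBall (R + 1) e) ⊆
        T.biUnion (fun e' => insert e' (Finset.univ.filter (fun e'' : Edge d L => e'' ∈ plaqNbhd e'))) := by
      intro e'' h
      rw [Finset.mem_filter] at h
      have h2 := h.2
      simp only [linkBall, Set.mem_setOf_eq] at h2
      obtain ⟨e', he', hor⟩ := h2
      rw [Finset.mem_biUnion]
      refine ⟨e', Finset.mem_filter.2 ⟨Finset.mem_univ _, he'⟩, ?_⟩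
      rcases hor with h3 | h3
      · rw [h3]; exact Finset.mem_insert_self _ _
      · exact Finset.mem_insert_of_mem (Finset.mem_filter.2 ⟨Finset.mem_univ _, h3⟩)
    calc _ ≤ (T.biUnion fun e' => insert e' (Finset.univ.filter (fun e'' : Edge d L => e'' ∈ plaqNbhd e'))).card :=
          Finset.card_le_card hsub
      _ ≤ ∑ e' ∈ T, (insert e' (Finset.univ.filter (fun e'' : Edge d L => e'' ∈ plaqNbhd e'))).card :=
          Finset.card_biUnion_le
      _ ≤ ∑ _e' ∈ T, (1 + 16 * (d * d)) := Finset.sum_le_sum fun e' _ =>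
          (Finset.card_insert_le _ _).trans (by have := card_filter_plaqNbhd_le (d := d) e'; omega)
      _ = T.card * (1 + 16 * (d * d)) := by rw [Finset.sum_const, smul_eq_mul]
      _ ≤ (1 + 16 * (d * d)) ^ R * (1 + 16 * (d * d)) := by
          gcongr; exact card_filter_linkBall_le e R
      _ = (1 + 16 * (d * d)) ^ (R + 1) := by ring

/-- **Sums of link terms supported in a plaquette ball**: at most `(1 + 16d²)^R · K`. [folklore] -/
theorem abs_sum_linkBall_le (R : ℕ) (e₀ : Edge d L) (g : Edge d L → ℝ) {K : ℝ} (hK0 : 0 ≤ K)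
    (h0 : ∀ e ∉ linkBall R e₀, g e = 0) (hK : ∀ e, |g e| ≤ K) :
    |∑ e, g e| ≤ (1 + 16 * (d * d)) ^ R * K := by
  have h := abs_sum_le_card_mul (Finset.univ.filter (fun e : Edge d L => e ∈ linkBall R e₀)) g
    (fun e he => h0 e (by simpa using he)) (fun e _ => hK e)
  refine h.trans ?_
  gcongr
  exact_mod_cast card_filter_linkBall_le e₀ R

/-- **Sums of plaquette terms through a link**: at most `4d² · K`. [folklore] -/
theorem abs_sum_plaq_le (e : Edge d L) (g : Site d L × Fin d × Fin d → ℝ) {K : ℝ} (hK0 : 0 ≤ K)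
    (h0 : ∀ p, e ∉ plaqLinks p.1 p.2.1 p.2.2 → g p = 0) (hK : ∀ p, |g p| ≤ K) :
    |∑ p, g p| ≤ 4 * (d * d) * K := by
  have h := abs_sum_le_card_mul
    (Finset.univ.filter (fun p : Site d L × Fin d × Fin d => e ∈ plaqLinks p.1 p.2.1 p.2.2)) g
    (fun p hp => h0 p (by simpa using hp)) (fun p _ => hK p)
  refine h.trans ?_
  gcongr
  exact_mod_cast card_filter_plaqLinks_le e

end Counting

/-! ## §3. The reduction -/

/-- **`ExtensiveDefect` from the two volume-uniform gradient bounds.** Given `c_W` bounding the unit-direction link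
gradients of the Wilson action and `c_A` bounding those of the order-`N` anchored terms `G^{(N)}_{e₀}` of the
constructed Lüscher series, both uniformly in the volume (and in the basis / anchor / link), the truncation defect of
EVERY smooth Lüscher series of `S_W` obeys `|𝓥_N(ιU)| ≤ b · |E|` with
`b = (1 + 16d²)^{N+1} · dim_ℝ M_n(ℂ) · c_W c_A`. [cite: Luscher2010Trivializing, §4.3–§4.5] -/
theorem extensiveDefect_of (N : ℕ) {cW cA : ℝ} (hcW : 0 ≤ cW) (hcA : 0 ≤ cA)
    (hW : ∀ (L : ℕ) [NeZero L] (e : Edge d L) (Y : Matrix (Fin n) (Fin n) ℂ), Y ∈ suAlgebra n → ‖Y‖ ≤ 1 →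
      ∀ U : GaugeConfig d L (Matrix.specialUnitaryGroup (Fin n) ℂ),
        |linkDeriv e Y (ambWilsonAction : AmbConfig d L n → ℝ) (WilsonFlow.coeConfig U)| ≤ cW)
    (hA : ∀ (L : ℕ) [NeZero L] (B : SuBasis n) (e₀ e : Edge d L) (Y : Matrix (Fin n) (Fin n) ℂ),
      Y ∈ suAlgebra n → ‖Y‖ ≤ 1 → ∀ U : GaugeConfig d L (Matrix.specialUnitaryGroup (Fin n) ℂ),
        |linkDeriv e Y (anchTerm B N e₀) (WilsonFlow.coeConfig U)| ≤ cA) :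
    ExtensiveDefect d n N := by
  refine ⟨(1 + 16 * (d * d)) ^ (N + 1) * (Module.finrank ℝ (Matrix (Fin n) (Fin n) ℂ) * (cW * cA)), ?_⟩
  intro L hL B Sk c hsm hser U
  rw [IsLuscherSeries.luscherV_eq hser (isLuscherSeries_wilsonSk B) hsm (fun k => contDiff_wilsonSk B k) N U]
  -- the defect of the constructed series, anchor by anchor
  set F : Edge d L → Edge d L → ℝ := fun e₀ e => ∑ a : B.ι,
    linkDeriv e (B.T a) (ambWilsonAction : AmbConfig d L n → ℝ) (WilsonFlow.coeConfig U) *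
      linkDeriv e (B.T a) (anchTerm B N e₀) (WilsonFlow.coeConfig U) with hF
  have hexp : luscherV B ambWilsonAction (wilsonSk d L B N) (WilsonFlow.coeConfig U) =
      ∑ e₀ : Edge d L, ∑ e : Edge d L, F e₀ e := by
    have hD : ∀ (e : Edge d L) (a : B.ι),
        linkDeriv e (B.T a) (wilsonSk d L B N) (WilsonFlow.coeConfig U) =
          ∑ e₀ : Edge d L, linkDeriv e (B.T a) (anchTerm B N e₀) (WilsonFlow.coeConfig U) := by
      intro e a
      have h := linkDeriv_finset_sum e (B.T a) Finset.univ (fun e₀ : Edge d L => anchTerm B N e₀)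
        (fun e₀ _ => contDiff_anchTerm B N e₀)
      rw [show wilsonSk d L B N = fun W => ∑ e₀ : Edge d L, anchTerm B N e₀ W from rfl]
      exact congrFun h (WilsonFlow.coeConfig U)
    unfold luscherV
    simp_rw [hD, Finset.mul_sum]
    exact (Finset.sum_congr rfl fun e _ => Finset.sum_comm).trans Finset.sum_comm
  rw [hexp]
  -- per anchor: only links of the ball contribute, at most `dim` colours, each term ≤ cW·cA
  have hKnn : 0 ≤ (Module.finrank ℝ (Matrix (Fin n) (Fin n) ℂ) : ℝ) * (cW * cA) := by positivity
  have key : ∀ e₀ : Edge d L, |∑ e : Edge d L, F e₀ e| ≤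
      (1 + 16 * (d * d)) ^ (N + 1) * (Module.finrank ℝ (Matrix (Fin n) (Fin n) ℂ) * (cW * cA)) := by
    intro e₀
    refine abs_sum_linkBall_le (N + 1) e₀ (F e₀) hKnn (fun e he => ?_) (fun e => ?_)
    · simp only [hF]
      refine Finset.sum_eq_zero fun a _ => ?_
      rw [linkDeriv_eq_zero_of_not_mem (B.T a) (Submodule.mem_inf.1 (anchTerm_mem B N e₀)).2 he, mul_zero]
    · simp only [hF]
      calc |∑ a : B.ι, linkDeriv e (B.T a) (ambWilsonAction : AmbConfig d L n → ℝ) (WilsonFlow.coeConfig U) *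
              linkDeriv e (B.T a) (anchTerm B N e₀) (WilsonFlow.coeConfig U)|
          ≤ ∑ a : B.ι, |linkDeriv e (B.T a) (ambWilsonAction : AmbConfig d L n → ℝ) (WilsonFlow.coeConfig U) *
              linkDeriv e (B.T a) (anchTerm B N e₀) (WilsonFlow.coeConfig U)| := Finset.abs_sum_le_sum_abs _ _
        _ ≤ ∑ _a : B.ι, cW * cA := Finset.sum_le_sum fun a _ => by
            rw [abs_mul]
            exact mul_le_mul (hW L e (B.T a) (B.mem a) (suBasis_norm_le_one B a) U)
              (hA L B e₀ e (B.T a) (B.mem a) (suBasis_norm_le_one B a) U) (abs_nonneg _) hcW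
        _ = Fintype.card B.ι * (cW * cA) := by rw [Finset.sum_const, nsmul_eq_mul, Finset.card_univ]
        _ ≤ Module.finrank ℝ (Matrix (Fin n) (Fin n) ℂ) * (cW * cA) := by
            have hWA : 0 ≤ cW * cA := mul_nonneg hcW hcA
            gcongr
            exact_mod_cast suBasis_card_le B
  calc |∑ e₀ : Edge d L, ∑ e : Edge d L, F e₀ e| ≤ ∑ e₀ : Edge d L, |∑ e : Edge d L, F e₀ e| :=
        Finset.abs_sum_le_sum_abs _ _
    _ ≤ ∑ _e₀ : Edge d L, (1 + 16 * (d * d)) ^ (N + 1) * (Module.finrank ℝ (Matrix (Fin n) (Fin n) ℂ) * (cW * cA)) :=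
        Finset.sum_le_sum fun e₀ _ => key e₀
    _ = (1 + 16 * (d * d)) ^ (N + 1) * (Module.finrank ℝ (Matrix (Fin n) (Fin n) ℂ) * (cW * cA)) *
          Fintype.card (Edge d L) := by
        rw [Finset.sum_const, nsmul_eq_mul, Finset.card_univ]; ring

end

end Summit.Ventures.LatticeQCDFlow.TrivializingMaps
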